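import Literature.Probability.Percolation.FlipFairKernel
import Summits.CriticalPhenomena.CardyFormulaZ2.Theorems.CardyMeckeFlipFlipErgodicityZ2StubPatternCampbellLimit

/-!
# Crux `FlipErgodicityZ2` (stmt-CriticalPhenomena-14825), line `registered`: the glue (E) of stub `stub_flipPassesToLimit_of_glue`

Route `Summits/CriticalPhenomena/CardyFormulaZ2/Theses/CardyMeckeFlip`.  The registered stub
`stub_flipPassesToLimit_of_glue` (the flip identity (F) passes to the limit) takes three
hypotheses — (A) the exact lattice Campbell–Mecke identity in kernel form (landed,
`stub_latticeCampbellKernel`), (B-L) the limit passage of the pattern Campbell functionals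
(landed, `stub_patternCampbellLimit`) and (B2) the uniform second moments of the lattice kernels —
and concludes `IsFlipFairKernel μ (M ε)` for every admissible Garban–Pete–Schramm pivotal-kernel
limit `M` of a subsequential quad-crossing limit `μ` of bond-`ℤ²` percolation at `p = ½`.

What these hypotheses do NOT contain is **node (C)**: the joint limit of the TOGGLED
(pattern-split) Campbell functionals `E[Σ_e w_e(ω) φ(mid e) g(pattern(ω_δ) toggled where e is
lattice-pivotal)]`, identified in the continuum by `QuadConfig.IsPivotalAt` (unprinted for
bond-`ℤ²`; `𝕋`-blueprint Garban–Pete–Schramm 2013 Thm 1.1 for `μ^Q` + GPS 2018 §6–7; it also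
absorbs the a.e.-strong measurability of the right-hand integrand of (F)).  This file proves the
glue (E), sorry-free:

  **node (C) ⟹ the registered stub, verbatim** (`flipPassesToLimit_of_nodeC`),

with node (C) stated along a mesh sequence `δ_k → 0⁺` realising `μ`, under the joint-convergence
clause of `IsZ2PivotalKernelLimit` along `δ_k` (all cutoffs), admissibility of the family `M`, and
uniform second moments along `δ_k` of every test function at every cutoff — all of which the
registered stub's context supplies, so that node (C) in this form is a REFORMULATION of the
registered stub modulo (A), (B-L), (B2) (conversely (F) + (A) + (B-L) give node (C)).  The variant
`flipPassesToLimit_of_nodeC_cutoff` takes node (C) quantified exactly like (B-L) (one cutoff `ε`,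
`Measurable (M ε)`, the joint clause at `ε`, one test function), a formally stronger node.

Proof.  Fix `μ, M, ε, (Q, g), φ`; take the mesh sequence `δ_k` of `IsZ2PivotalKernelLimit μ M`.
The uniform second moments along `δ_k` come from (B2) for `δ_k ≤ δ₀`, finitely many indices `k`
remaining (`exists_forall_sq_integral_le`).  Then the left side of (F) is `lim_k LHS_k` by (B-L),
`LHS_k = RHS_k` on the lattice by (A) (with the finite edge sets `E k ⊇ {e | φ(mid e) ≠ 0}` of
`exists_finset_of_hasCompactSupport`), and `RHS_k →` right side of (F) by node (C); conclude by
uniqueness of limits.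
-/

noncomputable section

open MeasureTheory Set Filter Metric Topology
open Literature.Probability.Percolation Literature.Probability.Percolation.QuadCrossing
open Literature.Probability.LatticeModels Literature.Probability.Distributions
open scoped ENNReal Topology BoundedContinuousFunction

namespace Summit.CriticalPhenomena.CardyFormulaZ2.Theorems.CardyMeckeFlip

/-! ### Uniform second moments along a mesh sequence -/

/-- **Uniform second moments along a mesh sequence.**  If the second moments
`E[⟨μ^ε_δ, |φ|⟩²]` are bounded by `C` for `0 < δ ≤ δ₀` and `δ_k → 0⁺`, then they are bounded
uniformly in `k` along `δ_k`: eventually `δ_k < δ₀`, and finitely many (Bochner, hence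
real-valued) moments remain (`IsBoundedUnder.bddAbove_range`). [folklore] -/
theorem exists_forall_sq_integral_le (ε : ℝ) (φ : ℂ → ℝ) {δs : ℕ → ℝ} (hpos : ∀ k, 0 < δs k)
    (h0 : Tendsto δs atTop (𝓝 0)) {C δ₀ : ℝ} (hδ₀ : 0 < δ₀)
    (hC : ∀ δ : ℝ, 0 < δ → δ ≤ δ₀ →
      ∫ ω, (∫ x, |φ x| ∂(z2PivotalMeasure ε δ ω)) ^ 2 ∂(bondPercolation (zdGraph 2) half) ≤ C) :
    ∃ C' : ℝ, ∀ k, ∫ ω, (∫ x, |φ x| ∂(z2PivotalMeasure ε (δs k) ω)) ^ 2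
      ∂(bondPercolation (zdGraph 2) half) ≤ C' := by
  have hev : ∀ᶠ k in atTop, ∫ ω, (∫ x, |φ x| ∂(z2PivotalMeasure ε (δs k) ω)) ^ 2
      ∂(bondPercolation (zdGraph 2) half) ≤ C := by
    filter_upwards [h0.eventually (eventually_lt_nhds hδ₀)] with k hk
    exact hC (δs k) (hpos k) hk.le
  obtain ⟨C', hC'⟩ := (isBoundedUnder_of_eventually_le hev).bddAbove_range
  exact ⟨C', fun k => hC' (mem_range_self k)⟩

/-! ### The glue: node (C) implies the registered stub -/

/-- **Glue (E) of stub 2b of the birth skeleton of crux `FlipErgodicityZ2`: node (C) implies the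
registered stub `stub_flipPassesToLimit_of_glue`, verbatim.**  Node (C) (first hypothesis): along
a mesh sequence `δ_k → 0⁺` realising `μ`, along which `(ω_δ, μ^ε_δ(ω))` converges jointly in law
to `(S, M ε S)` at every cutoff (the convergence clause of `IsZ2PivotalKernelLimit`), for an
admissible family `M` and given uniform second moments `sup_k E[⟨μ^ε_{δ_k}, |ψ|⟩²] < ∞` of every
`ψ ∈ C_c(ℂ)` at every cutoff: for every cutoff `ε > 0`, cylinder datum `(Q, g)`, `φ ∈ C_c(ℂ)` and
finite edge sets `E k ⊇ {e | φ(mid e) ≠ 0}`, the toggled lattice Campbell functionals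
`E[Σ_{e ∈ E k} w_e(ω) φ(mid e) g(pattern(ω_{δ_k}) toggled where e is lattice-pivotal)]` converge
to `∫∫ φ(x) g({i | Qᵢ ∈ S} toggled where x is pivotal) (M ε S)(dx) dμ(S)`.  Then (A) + (B-L) +
(B2) give (F): `LHS(F) = lim LHS_k` (B-L, uniform integrability from B2 along `δ_k`),
`LHS_k = RHS_k` (A), `RHS_k → RHS(F)` (C), and limits are unique. [folklore] -/
theorem flipPassesToLimit_of_nodeC :
    (∀ (μ : FiniteMeasure (QuadConfig (Set.univ : Set ℂ)))
      (M : ℝ → QuadConfig (Set.univ : Set ℂ) → Measure ℂ) (δs : ℕ → ℝ),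
      (∀ k, 0 < δs k) → Tendsto δs atTop (𝓝 0) →
        Tendsto (fun k => z2QuadLaw (Set.univ : Set ℂ) (δs k)) atTop (𝓝 μ) →
          (∀ ε : ℝ, 0 < ε → ∀ m (φ : Fin m → ℂ → ℝ), (∀ j, Continuous (φ j)) →
            (∀ j, HasCompactSupport (φ j)) →
              ∀ F : BoundedContinuousFunction (QuadConfig (Set.univ : Set ℂ) × (Fin m → ℝ)) ℝ,
                Tendsto
                  (fun k => ∫ ω, F (z2QuadConfig (Set.univ : Set ℂ) (δs k) ω,
                      fun j => ∫ x, φ j x ∂(z2PivotalMeasure ε (δs k) ω))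
                    ∂(bondPercolation (zdGraph 2) half))
                  atTop
                  (𝓝 (∫ S, F (S, fun j => ∫ x, φ j x ∂(M ε S))
                    ∂(μ : Measure (QuadConfig (Set.univ : Set ℂ)))))) →
          IsAdmissibleKernel (μ : Measure (QuadConfig (Set.univ : Set ℂ))) M →
          (∀ ε : ℝ, 0 < ε → ∀ φ : ℂ → ℝ, Continuous φ → HasCompactSupport φ →
            ∃ C, ∀ k, ∫ ω, (∫ x, |φ x| ∂(z2PivotalMeasure ε (δs k) ω)) ^ 2
              ∂(bondPercolation (zdGraph 2) half) ≤ C) →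
          ∀ ε : ℝ, 0 < ε → ∀ n (Q : Fin n → Quad (Set.univ : Set ℂ)) (g : Set (Fin n) → ℝ)
            (φ : ℂ → ℝ), Continuous φ → HasCompactSupport φ →
              ∀ E : ℕ → Finset (Site 2 × Fin 2),
                (∀ k, ∀ p ∉ E k, φ (edgeMidpoint (δs k) p.1 p.2) = 0) →
                Tendsto
                  (fun k => ∫ ω, ∑ p ∈ E k, (pivotalWeight ε (δs k) ω p.1 p.2).toReal *
                    (φ (edgeMidpoint (δs k) p.1 p.2) *
                      g {i | Xor (Q i ∈ z2QuadConfig (Set.univ : Set ℂ) (δs k) ω)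
                        (¬ (Q i ∈ z2QuadConfig (Set.univ : Set ℂ) (δs k) ω ↔
                          Q i ∈ z2QuadConfig (Set.univ : Set ℂ) (δs k)
                            (symmDiff ω {edgeFrom p.1 p.2})))})
                    ∂(bondPercolation (zdGraph 2) half))
                  atTop
                  (𝓝 (∫ S, ∫ x, φ x * g {i | Xor (Q i ∈ S) (S.IsPivotalAt x (Q i))} ∂(M ε S)
                    ∂(μ : Measure (QuadConfig (Set.univ : Set ℂ)))))) →
    (∀ (ε δ : ℝ), 0 < ε → 0 < δ → ∀ (n : ℕ) (Q : Fin n → Quad (Set.univ : Set ℂ))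
      (g : Set (Fin n) → ℝ) (φ : ℂ → ℝ), Continuous φ → HasCompactSupport φ →
        ∀ E : Finset (Site 2 × Fin 2),
          (∀ p : Site 2 × Fin 2, φ (edgeMidpoint δ p.1 p.2) ≠ 0 → p ∈ E) →
            ∫ ω, ∫ z, φ z * g {i | Q i ∈ z2QuadConfig (Set.univ : Set ℂ) δ ω}
                ∂(z2PivotalMeasure ε δ ω) ∂(bondPercolation (zdGraph 2) half) =
              ∫ ω, ∑ p ∈ E, (pivotalWeight ε δ ω p.1 p.2).toReal *
                  (φ (edgeMidpoint δ p.1 p.2) *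
                    g {i | Xor (Q i ∈ z2QuadConfig (Set.univ : Set ℂ) δ ω)
                      (¬ (Q i ∈ z2QuadConfig (Set.univ : Set ℂ) δ ω ↔
                        Q i ∈ z2QuadConfig (Set.univ : Set ℂ) δ (symmDiff ω {edgeFrom p.1 p.2})))})
                ∂(bondPercolation (zdGraph 2) half)) →
    (∀ (μ : FiniteMeasure (QuadConfig (Set.univ : Set ℂ)))
      (M : ℝ → QuadConfig (Set.univ : Set ℂ) → Measure ℂ) (δs : ℕ → ℝ),
      (∀ k, 0 < δs k) → Tendsto δs atTop (𝓝 0) →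
        Tendsto (fun k => z2QuadLaw (Set.univ : Set ℂ) (δs k)) atTop (𝓝 μ) →
          ∀ ε : ℝ, 0 < ε → Measurable (M ε) →
            (∀ (m : ℕ) (φ : Fin m → ℂ → ℝ), (∀ j, Continuous (φ j)) →
              (∀ j, HasCompactSupport (φ j)) →
                ∀ F : BoundedContinuousFunction (QuadConfig (Set.univ : Set ℂ) × (Fin m → ℝ)) ℝ,
                  Tendsto
                    (fun k => ∫ ω, F (z2QuadConfig (Set.univ : Set ℂ) (δs k) ω,
                        fun j => ∫ x, φ j x ∂(z2PivotalMeasure ε (δs k) ω))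
                      ∂(bondPercolation (zdGraph 2) half))
                    atTop
                    (𝓝 (∫ S, F (S, fun j => ∫ x, φ j x ∂(M ε S))
                      ∂(μ : Measure (QuadConfig (Set.univ : Set ℂ)))))) →
            ∀ φ : ℂ → ℝ, Continuous φ → HasCompactSupport φ →
              (∃ C : ℝ, ∀ k, ∫ ω, (∫ x, |φ x| ∂(z2PivotalMeasure ε (δs k) ω)) ^ 2
                  ∂(bondPercolation (zdGraph 2) half) ≤ C) →
                ∀ (n : ℕ) (Q : Fin n → Quad (Set.univ : Set ℂ)) (g : Set (Fin n) → ℝ),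
                  Tendsto
                    (fun k => ∫ ω, ∫ z, φ z * g {i | Q i ∈ z2QuadConfig (Set.univ : Set ℂ) (δs k) ω}
                      ∂(z2PivotalMeasure ε (δs k) ω) ∂(bondPercolation (zdGraph 2) half))
                    atTop
                    (𝓝 (∫ S, ∫ x, φ x * g {i | Q i ∈ S} ∂(M ε S)
                      ∂(μ : Measure (QuadConfig (Set.univ : Set ℂ)))))) →
    (∀ ε : ℝ, 0 < ε → ∀ φ : ℂ → ℝ, Continuous φ → HasCompactSupport φ →
      ∃ C δ₀ : ℝ, 0 < δ₀ ∧ ∀ δ : ℝ, 0 < δ → δ ≤ δ₀ →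
        ∫ ω, (∫ x, |φ x| ∂(z2PivotalMeasure ε δ ω)) ^ 2 ∂(bondPercolation (zdGraph 2) half) ≤ C) →
    ∀ (μ : FiniteMeasure (QuadConfig (Set.univ : Set ℂ)))
      (M : ℝ → QuadConfig (Set.univ : Set ℂ) → Measure ℂ),
      IsZ2PivotalKernelLimit μ M →
        IsAdmissibleKernel (μ : Measure (QuadConfig (Set.univ : Set ℂ))) M →
          ∀ ε : ℝ, 0 < ε →
            IsFlipFairKernel (μ : Measure (QuadConfig (Set.univ : Set ℂ))) (M ε) := by
  intro hC hA hBL hB2 μ M hlim hadm ε hε n Q g φ hφ hφc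
  -- the mesh sequence of the pivotal-kernel limit and its joint convergence clause
  obtain ⟨δs, hpos, h0, hlaw, hjoint⟩ := hlim
  have hM : Measurable (M ε) := hadm.measurable ε
  -- uniform second moments along `δs` (B2 + finitely many exceptional indices)
  have hUI : ∀ ε' : ℝ, 0 < ε' → ∀ ψ : ℂ → ℝ, Continuous ψ → HasCompactSupport ψ →
      ∃ C : ℝ, ∀ k, ∫ ω, (∫ x, |ψ x| ∂(z2PivotalMeasure ε' (δs k) ω)) ^ 2
        ∂(bondPercolation (zdGraph 2) half) ≤ C := by
    intro ε' hε' ψ hψ hψc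
    obtain ⟨C, δ₀, hδ₀, hCδ⟩ := hB2 ε' hε' ψ hψ hψc
    exact exists_forall_sq_integral_le ε' ψ hpos h0 hδ₀ hCδ
  -- finite edge sets carrying `φ` at each mesh
  have hE : ∀ k, ∃ E : Finset (Site 2 × Fin 2),
      ∀ p : Site 2 × Fin 2, φ (edgeMidpoint (δs k) p.1 p.2) ≠ 0 → p ∈ E := fun k =>
    exists_finset_of_hasCompactSupport (hpos k) hφc
  choose E hE using hE
  have hE' : ∀ k, ∀ p ∉ E k, φ (edgeMidpoint (δs k) p.1 p.2) = 0 := fun k p hp =>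
    not_imp_comm.1 (hE k p) hp
  -- (B-L): the left-hand side of (F) is the limit of the lattice left-hand sides
  have hLHS := hBL μ M δs hpos h0 hlaw ε hε hM (hjoint ε hε) φ hφ hφc (hUI ε hε φ hφ hφc) n Q g
  -- (C): the lattice right-hand sides converge to the right-hand side of (F)
  have hRHS := hC μ M δs hpos h0 hlaw hjoint hadm hUI ε hε n Q g φ hφ hφc E hE'
  -- (A): on the lattice the two sides agree exactly
  have hlat : ∀ k,
      ∫ ω, ∑ p ∈ E k, (pivotalWeight ε (δs k) ω p.1 p.2).toReal *
          (φ (edgeMidpoint (δs k) p.1 p.2) *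
            g {i | Xor (Q i ∈ z2QuadConfig (Set.univ : Set ℂ) (δs k) ω)
              (¬ (Q i ∈ z2QuadConfig (Set.univ : Set ℂ) (δs k) ω ↔
                Q i ∈ z2QuadConfig (Set.univ : Set ℂ) (δs k) (symmDiff ω {edgeFrom p.1 p.2})))})
        ∂(bondPercolation (zdGraph 2) half) =
      ∫ ω, ∫ z, φ z * g {i | Q i ∈ z2QuadConfig (Set.univ : Set ℂ) (δs k) ω}
        ∂(z2PivotalMeasure ε (δs k) ω) ∂(bondPercolation (zdGraph 2) half) := fun k =>
    (hA ε (δs k) hε (hpos k) n Q g φ hφ hφc (E k) (hE k)).symm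
  -- uniqueness of limits
  exact tendsto_nhds_unique hLHS (hRHS.congr hlat)

/-- **Glue (E), single-cutoff variant**: node (C) quantified exactly like the landed (B-L)
`stub_patternCampbellLimit` — one cutoff `ε`, `Measurable (M ε)`, the joint-convergence clause at
`ε` only, one test function `φ` with its uniform second moments (plus admissibility of the family
and the finite edge sets) — also implies the registered stub: this node is formally stronger than
the all-cutoffs node of `flipPassesToLimit_of_nodeC`. [folklore] -/
theorem flipPassesToLimit_of_nodeC_cutoff :
    (∀ (μ : FiniteMeasure (QuadConfig (Set.univ : Set ℂ)))
      (M : ℝ → QuadConfig (Set.univ : Set ℂ) → Measure ℂ) (δs : ℕ → ℝ),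
      (∀ k, 0 < δs k) → Tendsto δs atTop (𝓝 0) →
        Tendsto (fun k => z2QuadLaw (Set.univ : Set ℂ) (δs k)) atTop (𝓝 μ) →
          ∀ ε : ℝ, 0 < ε → Measurable (M ε) →
            (∀ m (φ : Fin m → ℂ → ℝ), (∀ j, Continuous (φ j)) →
              (∀ j, HasCompactSupport (φ j)) →
                ∀ F : BoundedContinuousFunction (QuadConfig (Set.univ : Set ℂ) × (Fin m → ℝ)) ℝ,
                  Tendsto
                    (fun k => ∫ ω, F (z2QuadConfig (Set.univ : Set ℂ) (δs k) ω,
                        fun j => ∫ x, φ j x ∂(z2PivotalMeasure ε (δs k) ω))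
                      ∂(bondPercolation (zdGraph 2) half))
                    atTop
                    (𝓝 (∫ S, F (S, fun j => ∫ x, φ j x ∂(M ε S))
                      ∂(μ : Measure (QuadConfig (Set.univ : Set ℂ)))))) →
            IsAdmissibleKernel (μ : Measure (QuadConfig (Set.univ : Set ℂ))) M →
            ∀ φ : ℂ → ℝ, Continuous φ → HasCompactSupport φ →
              (∃ C : ℝ, ∀ k, ∫ ω, (∫ x, |φ x| ∂(z2PivotalMeasure ε (δs k) ω)) ^ 2
                  ∂(bondPercolation (zdGraph 2) half) ≤ C) →
                ∀ n (Q : Fin n → Quad (Set.univ : Set ℂ)) (g : Set (Fin n) → ℝ)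
                  (E : ℕ → Finset (Site 2 × Fin 2)),
                  (∀ k, ∀ p ∉ E k, φ (edgeMidpoint (δs k) p.1 p.2) = 0) →
                  Tendsto
                    (fun k => ∫ ω, ∑ p ∈ E k, (pivotalWeight ε (δs k) ω p.1 p.2).toReal *
                      (φ (edgeMidpoint (δs k) p.1 p.2) *
                        g {i | Xor (Q i ∈ z2QuadConfig (Set.univ : Set ℂ) (δs k) ω)
                          (¬ (Q i ∈ z2QuadConfig (Set.univ : Set ℂ) (δs k) ω ↔
                            Q i ∈ z2QuadConfig (Set.univ : Set ℂ) (δs k)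
                              (symmDiff ω {edgeFrom p.1 p.2})))})
                      ∂(bondPercolation (zdGraph 2) half))
                    atTop
                    (𝓝 (∫ S, ∫ x, φ x * g {i | Xor (Q i ∈ S) (S.IsPivotalAt x (Q i))} ∂(M ε S)
                      ∂(μ : Measure (QuadConfig (Set.univ : Set ℂ)))))) →
    (∀ (ε δ : ℝ), 0 < ε → 0 < δ → ∀ (n : ℕ) (Q : Fin n → Quad (Set.univ : Set ℂ))
      (g : Set (Fin n) → ℝ) (φ : ℂ → ℝ), Continuous φ → HasCompactSupport φ →
        ∀ E : Finset (Site 2 × Fin 2),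
          (∀ p : Site 2 × Fin 2, φ (edgeMidpoint δ p.1 p.2) ≠ 0 → p ∈ E) →
            ∫ ω, ∫ z, φ z * g {i | Q i ∈ z2QuadConfig (Set.univ : Set ℂ) δ ω}
                ∂(z2PivotalMeasure ε δ ω) ∂(bondPercolation (zdGraph 2) half) =
              ∫ ω, ∑ p ∈ E, (pivotalWeight ε δ ω p.1 p.2).toReal *
                  (φ (edgeMidpoint δ p.1 p.2) *
                    g {i | Xor (Q i ∈ z2QuadConfig (Set.univ : Set ℂ) δ ω)
                      (¬ (Q i ∈ z2QuadConfig (Set.univ : Set ℂ) δ ω ↔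
                        Q i ∈ z2QuadConfig (Set.univ : Set ℂ) δ (symmDiff ω {edgeFrom p.1 p.2})))})
                ∂(bondPercolation (zdGraph 2) half)) →
    (∀ (μ : FiniteMeasure (QuadConfig (Set.univ : Set ℂ)))
      (M : ℝ → QuadConfig (Set.univ : Set ℂ) → Measure ℂ) (δs : ℕ → ℝ),
      (∀ k, 0 < δs k) → Tendsto δs atTop (𝓝 0) →
        Tendsto (fun k => z2QuadLaw (Set.univ : Set ℂ) (δs k)) atTop (𝓝 μ) →
          ∀ ε : ℝ, 0 < ε → Measurable (M ε) →
            (∀ (m : ℕ) (φ : Fin m → ℂ → ℝ), (∀ j, Continuous (φ j)) →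
              (∀ j, HasCompactSupport (φ j)) →
                ∀ F : BoundedContinuousFunction (QuadConfig (Set.univ : Set ℂ) × (Fin m → ℝ)) ℝ,
                  Tendsto
                    (fun k => ∫ ω, F (z2QuadConfig (Set.univ : Set ℂ) (δs k) ω,
                        fun j => ∫ x, φ j x ∂(z2PivotalMeasure ε (δs k) ω))
                      ∂(bondPercolation (zdGraph 2) half))
                    atTop
                    (𝓝 (∫ S, F (S, fun j => ∫ x, φ j x ∂(M ε S))
                      ∂(μ : Measure (QuadConfig (Set.univ : Set ℂ)))))) →
            ∀ φ : ℂ → ℝ, Continuous φ → HasCompactSupport φ →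
              (∃ C : ℝ, ∀ k, ∫ ω, (∫ x, |φ x| ∂(z2PivotalMeasure ε (δs k) ω)) ^ 2
                  ∂(bondPercolation (zdGraph 2) half) ≤ C) →
                ∀ (n : ℕ) (Q : Fin n → Quad (Set.univ : Set ℂ)) (g : Set (Fin n) → ℝ),
                  Tendsto
                    (fun k => ∫ ω, ∫ z, φ z * g {i | Q i ∈ z2QuadConfig (Set.univ : Set ℂ) (δs k) ω}
                      ∂(z2PivotalMeasure ε (δs k) ω) ∂(bondPercolation (zdGraph 2) half))
                    atTop
                    (𝓝 (∫ S, ∫ x, φ x * g {i | Q i ∈ S} ∂(M ε S)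
                      ∂(μ : Measure (QuadConfig (Set.univ : Set ℂ)))))) →
    (∀ ε : ℝ, 0 < ε → ∀ φ : ℂ → ℝ, Continuous φ → HasCompactSupport φ →
      ∃ C δ₀ : ℝ, 0 < δ₀ ∧ ∀ δ : ℝ, 0 < δ → δ ≤ δ₀ →
        ∫ ω, (∫ x, |φ x| ∂(z2PivotalMeasure ε δ ω)) ^ 2 ∂(bondPercolation (zdGraph 2) half) ≤ C) →
    ∀ (μ : FiniteMeasure (QuadConfig (Set.univ : Set ℂ)))
      (M : ℝ → QuadConfig (Set.univ : Set ℂ) → Measure ℂ),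
      IsZ2PivotalKernelLimit μ M →
        IsAdmissibleKernel (μ : Measure (QuadConfig (Set.univ : Set ℂ))) M →
          ∀ ε : ℝ, 0 < ε →
            IsFlipFairKernel (μ : Measure (QuadConfig (Set.univ : Set ℂ))) (M ε) :=
  fun hC => flipPassesToLimit_of_nodeC
    fun μ M δs hpos h0 hlaw hjoint hadm hUI ε hε n Q g φ hφ hφc E hE =>
      hC μ M δs hpos h0 hlaw ε hε (hadm.measurable ε) (hjoint ε hε) hadm φ hφ hφc
        (hUI ε hε φ hφ hφc) n Q g E hE

end Summit.CriticalPhenomena.CardyFormulaZ2.Theorems.CardyMeckeFlip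

end
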